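import Summits.NavierStokesRegularity.TurbBounds.Certs.N1bG2n12.EvalData8
import Summits.NavierStokesRegularity.TurbBounds.CouplingSplit
import Summits.NavierStokesRegularity.TurbBounds.TailN1bG2n12LadderForms
import Summits.NavierStokesRegularity.TurbBounds.TailN1bG2n12Ext
import Summits.NavierStokesRegularity.TurbBounds.QuadFormEval
import HarnessLib

/-!
# Row RB-N1b tail lemma (dim 42) — structured quadratic form of the literal rule piece `TW`, part 15/16 (v2.1: list-level evaluation)
(cell `pub-turb` / `turb-bounds`; v2; GENERATED by pub-turb-cert gen 8 (prover-pub-turb-cert-g8-0) running the gen-7 tool `emit_pieces_v21.py N1bG2n12` from the staged `Certs/N1bG2n12/EvalData*.lean`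
literals; the identity says 'this literal (projected) piece IS the Legendre–Galerkin object of rbsdp SPEC 3.3–3.6 on the kept coordinates'
(LEAN-MAP data item (a) for row RB-N1b). Proof: `QuadFormEval.dotProduct_mulVec_eq_rowsEval` turns the quadratic form into a structural
recursion over the row lists (unfolded by `simp only`, linear in the 222 listed entries), then `ring` over the ladder forms.)

HONEST FRAMING: rigorous bounds for the stated PDE and boundary conditions; no claim about physical turbulence beyond the bound.
-/

set_option linter.style.longLine false
set_option linter.style.setOption false
set_option maxRecDepth 100000

noncomputable section

namespace Summit.NavierStokesRegularity.TurbBounds.TailN1bG2n12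

open Finset Matrix Literature.Computation.Certificates
open Summit.NavierStokesRegularity.TurbBounds.LadderTail (w phi lam)
open Summit.NavierStokesRegularity.TurbBounds.CouplingSplit (couplingMode)
open Summit.NavierStokesRegularity.TurbBounds.Certs.N1bG2n12.Evaluator

set_option maxHeartbeats 20000000 in
/-- structured quadratic form of the literal piece `TW` (42×42 kept coordinates, 222 listed / 48 nonzero entries) -/
theorem quadForm_TW (x : Fin 42 → ℝ) :
    x ⬝ᵥ (TW.map (Rat.cast : ℚ → ℝ) *ᵥ x) = (w 13 * bL x 13 ^ 2 + w 14 * bL x 14 ^ 2 + w 15 * bL x 15 ^ 2 + w 16 * bL x 16 ^ 2 + w 17 * bL x 17 ^ 2 + w 18 * bL x 18 ^ 2 + w 19 * bL x 19 ^ 2 + w 20 * bL x 20 ^ 2) + phi 20 * aL x 20 ^ 2 + phi 21 * aL x 21 ^ 2 + lam 20 * (phi 21 * xc x 21 ^ 2 + phi 22 * xc x 22 ^ 2) := by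
  rw [show TW = matrixOfRows 42 42 TW_rows from rfl,
    QuadFormEval.dotProduct_mulVec_eq_rowsEval TW_rows x (ext x) (ext_val x) (ext_zero x)]
  simp only [TW_rows, TW_rows_r0, TW_rows_r1, TW_rows_r2, TW_rows_r3, TW_rows_r4, TW_rows_r5, TW_rows_r6, TW_rows_r7, TW_rows_r8, TW_rows_r9, TW_rows_r10, TW_rows_r11, TW_rows_r12, TW_rows_r13, TW_rows_r14, TW_rows_r15, TW_rows_r16, TW_rows_r17, TW_rows_r18, TW_rows_r19, TW_rows_r20, TW_rows_r21, TW_rows_r22, TW_rows_r23, TW_rows_r24, TW_rows_r25, TW_rows_r26, TW_rows_r27, TW_rows_r28, TW_rows_r29, TW_rows_r30, TW_rows_r31, TW_rows_r32, TW_rows_r33, TW_rows_r34, TW_rows_r35, TW_rows_r36, TW_rows_r37, TW_rows_r38, TW_rows_r39, TW_rows_r40, TW_rows_r41,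
    QuadFormEval.rowsEval_cons, QuadFormEval.rowsEval_nil, QuadFormEval.rowEval_cons, QuadFormEval.rowEval_nil, ext, Rat.cast_zero, zero_mul, mul_zero, zero_add, add_zero,
    bL, aL, xc, w, phi, lam]
  push_cast
  ring

end Summit.NavierStokesRegularity.TurbBounds.TailN1bG2n12

end
-- build-lane re-dispatch touch 2026-08-24 (lead decision 262/E1); no declaration change
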